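import Literature.MathematicalPhysics.QuantumLattice.WilsonDiracSliceReflection
import Literature.LinearAlgebra.Matrix.TransferProductReflection
import Literature.LinearAlgebra.Matrix.GramDeterminantKernel
import HarnessLib

/-!
# The antiperiodic Wilson determinant as a reflection-positive Gram kernel

Let `U` be an `SU(N)` lattice gauge field on `(ℤ/2T)⁴` (`2T = h + 1 + (h + 1)`) and `m > -1`.
Combining the block-determinant formula `det_wilsonBlock_antiperiodic` (Lüscher's transfer
matrix for Wilson fermions, Comm. Math. Phys. 54 (1977) 283) with the reflection formula
`reverse_prod_transfer_reflect` for the transfer product and the Cauchy–Binet Gram expansion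
`det_one_add_eq_sum_gram`, we obtain
`det D_AP[U, m] = ∑_{q', q} Φ_{q'}(U) · Q̂_{q'q}(U) · conj Φ_q(Θ₀U)`
(`fermionDet_wilsonDiracAP_eq_sum_gram`), where `Θ₀` is the site reflection in the hyperplanes
`t = 0, T`, the fermionic features `Φ_q(U)` (`fermionFeature`) are functions of the links in
`0 ≤ t ≤ T` not inside the plane `t = 0`, and the fermionic coupling `Q̂(U)` (`fermionCoupling`)
is a positive semidefinite matrix (`posSemidef_fermionCoupling`) built from the slice data of
the two reflection planes only. Positivity uses `m > -1` through `a_t ≥ (m+1)·1 > 0`. This is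
the determinant form of the Osterwalder–Seiler site-reflection positivity of Wilson fermions
(Ann. Phys. 110 (1978) 440, §§2–3; Montvay–Münster (1994) §4.2.3), with no Grassmann variables.
-/

noncomputable section

-- The time-slice index types (`((κ × Fin 2) ⊕ (κ × Fin 2)) × Fin (n+1)` and the Gram indices built
-- from them) are too deep for the default instance-search size bound (`DecidableEq`, needed by
-- `Matrix.det`).
set_option synthInstance.maxSize 512

namespace Literature.MathematicalPhysics.QuantumLattice

/-- The index of one spinor half of a time slice of the torus `(ℤ/2T)⁴`, `T = h + 1`:
(spatial site, colour, half spin). [folklore] -/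
abbrev SliceIdx (h N : ℕ) : Type := ((Fin 3 → ZMod (h + 1 + (h + 1))) × Fin N) × Fin 2

/-- The spinor index of a time slice: upper ⊕ lower components. [folklore] -/
abbrev SpinorIdx (h N : ℕ) : Type := SliceIdx h N ⊕ SliceIdx h N

/-- The index of the Gram expansion: row selections of the stacked matrix `[1; 𝔓]`. [folklore] -/
abbrev GramIdx (h N : ℕ) : Type := SpinorIdx h N → SpinorIdx h N ⊕ SpinorIdx h N

section FermionGram

open _root_.Matrix Literature.Probability.LatticeModels QuantumFieldTheory Literature.LinearAlgebra.Matrix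
open scoped Kronecker ComplexOrder

variable {h N : ℕ}

local notation "𝕊𝕌" => Matrix.specialUnitaryGroup (Fin N) ℂ
local notation "ρ₀" => unitaryFundamentalRep (Fin N) ℂ

/-! ### The slice data of an `SU(N)` gauge field with antiperiodic quarks -/

/-- The spatial diagonal block `a_t = d_t` of the antiperiodic Wilson–Dirac operator of `U`. [folklore] -/
abbrev apDiag (U : GaugeConfig 4 (h + 1 + (h + 1)) 𝕊𝕌) (m : ℝ) (t : Fin (h + 1 + (h + 1))) :
    Matrix (SliceIdx h N) (SliceIdx h N) ℂ :=
  sliceDiag ρ₀ (apLift U) m t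

/-- The spatial off-diagonal block `b_t` of the antiperiodic Wilson–Dirac operator of `U`. [folklore] -/
abbrev apOff (U : GaugeConfig 4 (h + 1 + (h + 1)) 𝕊𝕌) (t : Fin (h + 1 + (h + 1))) :
    Matrix (SliceIdx h N) (SliceIdx h N) ℂ :=
  sliceOff ρ₀ (apLift U) t

/-- The (periodic, `SU(N)`) temporal block `w_t` of `U`. [folklore] -/
abbrev apLink (U : GaugeConfig 4 (h + 1 + (h + 1)) 𝕊𝕌) (t : Fin (h + 1 + (h + 1))) :
    Matrix (SliceIdx h N) (SliceIdx h N) ℂ :=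
  sliceLink ρ₀ (unitaryLift U) t

/-- The transfer step `𝒴_t` of the slice `t`. [folklore] -/
abbrev apStep (U : GaugeConfig 4 (h + 1 + (h + 1)) 𝕊𝕌) (m : ℝ) (t : Fin (h + 1 + (h + 1))) :
    Matrix (SpinorIdx h N) (SpinorIdx h N) ℂ :=
  transferStep (apDiag U m t) (apOff U t) (apDiag U m t)

/-- **The positive-time transfer product** `𝔓(U) = Ŵ_{T-1}ᴴ 𝒴_{T-1} ⋯ 𝒴₁ Ŵ₀ᴴ` of the gauge field
`U` (a function of the links with both endpoints in `0 ≤ t ≤ T = L/2` not inside the plane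
`t = 0`). [folklore] -/
def posTransfer (U : GaugeConfig 4 (h + 1 + (h + 1)) 𝕊𝕌) (m : ℝ) : Matrix (SpinorIdx h N) (SpinorIdx h N) ℂ :=
  halfTransfer h (fun t => linkBlock (apLink U t)) (apStep U m)

/-- The positive real scalar `c(U) = ∏_{0 < s < T} det a_s` of the interior positive slices. [folklore] -/
def posDiagDet (U : GaugeConfig 4 (h + 1 + (h + 1)) 𝕊𝕌) (m : ℝ) : ℂ :=
  ∏ i : Fin h, (apDiag U m (Fin.castAdd (h + 1) i.succ)).det

/-- **The fermionic feature** `Φ_q(U) = c(U) · Ψ_q(𝔓(U))`. [folklore] -/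
def fermionFeature (U : GaugeConfig 4 (h + 1 + (h + 1)) 𝕊𝕌) (m : ℝ) (q : GramIdx h N) : ℂ :=
  posDiagDet U m * gramFeature (posTransfer U m) q

/-- **The fermionic coupling** `Q̂(U) = (det a₀ · det a_T) · Q(𝒴₀, 𝒴_T)` on the two reflection
slices `0` and `T = h + 1`. [folklore] -/
def fermionCoupling (U : GaugeConfig 4 (h + 1 + (h + 1)) 𝕊𝕌) (m : ℝ) :
    Matrix (GramIdx h N) (GramIdx h N) ℂ :=
  ((apDiag U m 0).det * (apDiag U m (Fin.natAdd (h + 1) 0)).det) •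
    gramCoupling (apStep U m 0) (apStep U m (Fin.natAdd (h + 1) 0))

/-! ### Positivity of the slice data (`m > -1`) -/

variable [NeZero N]

/-- `a_t` is positive definite. [folklore] -/
theorem posDef_apDiag (U : GaugeConfig 4 (h + 1 + (h + 1)) 𝕊𝕌) {m : ℝ} (hm : -1 < m)
    (t : Fin (h + 1 + (h + 1))) : (apDiag U m t).PosDef :=
  posDef_sliceDiag _ unitaryFundamentalRep_mem_unitaryGroup _ hm t

/-- `det a_t` is a positive real number. [folklore] -/
theorem det_apDiag_pos (U : GaugeConfig 4 (h + 1 + (h + 1)) 𝕊𝕌) {m : ℝ} (hm : -1 < m)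
    (t : Fin (h + 1 + (h + 1))) : 0 < (apDiag U m t).det :=
  (posDef_apDiag U hm t).det_pos

/-- `det a_t` is invertible. [folklore] -/
theorem isUnit_det_apDiag (U : GaugeConfig 4 (h + 1 + (h + 1)) 𝕊𝕌) {m : ℝ} (hm : -1 < m)
    (t : Fin (h + 1 + (h + 1))) : IsUnit (apDiag U m t).det :=
  isUnit_iff_ne_zero.2 (det_apDiag_pos U hm t).ne'

/-- `𝒴_t` is Hermitian positive definite. [folklore] -/
theorem posDef_apStep (U : GaugeConfig 4 (h + 1 + (h + 1)) 𝕊𝕌) {m : ℝ} (hm : -1 < m)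
    (t : Fin (h + 1 + (h + 1))) : (apStep U m t).PosDef :=
  posDef_transferStep (posDef_apDiag U hm t) (posDef_apDiag U hm t)

omit [NeZero N] in
/-- `w_t` is unitary. [folklore] -/
theorem apLink_mul_conjTranspose (U : GaugeConfig 4 (h + 1 + (h + 1)) 𝕊𝕌) (t : Fin (h + 1 + (h + 1))) :
    apLink U t * (apLink U t)ᴴ = 1 :=
  sliceLink_mul_conjTranspose _ unitaryFundamentalRep_mem_unitaryGroup _ t

/-! ### The determinant formula -/

/-- **Transfer-matrix formula for the antiperiodic Wilson fermion determinant of an `SU(N)`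
gauge field**: `det D_AP[U, m] = (∏ₜ det a_t) · det (1 + Ŵ_{2T-1}ᴴ 𝒴_{2T-1} ⋯ Ŵ₀ᴴ 𝒴₀)`
(Lüscher 1977; Montvay–Münster §4.2.3; here as an identity of finite determinants). [folklore] -/
theorem fermionDet_wilsonDiracAP_eq_transfer (U : GaugeConfig 4 (h + 1 + (h + 1)) 𝕊𝕌) {m : ℝ} (hm : -1 < m) :
    fermionDet (wilsonDiracAP U m) = (∏ t, (apDiag U m t).det) *
      (1 + (List.ofFn fun t => (linkBlock (apLink U t))ᴴ * apStep U m t).reverse.prod).det := by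
  rw [fermionDet, wilsonDiracAP_def,
    det_wilsonDirac_eq_det_wilsonBlock _ unitaryFundamentalRep_mem_unitaryGroup, sliceLink_apLift,
    det_wilsonBlock_antiperiodic (sliceDiag ρ₀ (apLift U) m) (sliceOff ρ₀ (apLift U)) (sliceDiag ρ₀ (apLift U) m)
      (sliceLink ρ₀ (unitaryLift U)) (fun t => isUnit_det_apDiag U hm t) (fun t => apLink_mul_conjTranspose U t)]
  simp only [det_sliceLink_unitaryLift, Finset.prod_const_one, mul_one]
  rfl

/-! ### Reflection -/

/-- `det a_t` is real. [folklore] -/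
theorem conj_det_apDiag (U : GaugeConfig 4 (h + 1 + (h + 1)) 𝕊𝕌) {m : ℝ} (hm : -1 < m)
    (t : Fin (h + 1 + (h + 1))) : (starRingEnd ℂ) (apDiag U m t).det = (apDiag U m t).det :=
  Complex.conj_eq_iff_im.2 (Complex.nonneg_iff.1 (det_apDiag_pos U hm t).le).2.symm

/-- `c(U)` is real. [folklore] -/
theorem conj_posDiagDet (U : GaugeConfig 4 (h + 1 + (h + 1)) 𝕊𝕌) {m : ℝ} (hm : -1 < m) :
    (starRingEnd ℂ) (posDiagDet U m) = posDiagDet U m := by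
  rw [posDiagDet, map_prod]
  exact Finset.prod_congr rfl fun i _ => conj_det_apDiag U hm _

/-- `det 𝒴_t` is invertible. [folklore] -/
theorem isUnit_det_apStep (U : GaugeConfig 4 (h + 1 + (h + 1)) 𝕊𝕌) {m : ℝ} (hm : -1 < m)
    (t : Fin (h + 1 + (h + 1))) : IsUnit (apStep U m t).det :=
  isUnit_iff_ne_zero.2 (posDef_apStep U hm t).det_pos.ne'

omit [NeZero N] in
/-- The spatial diagonal block of the reflected field: `a_t[Θ₀U] = a_{-t}[U]`. [folklore] -/
theorem apDiag_siteReflect (U : GaugeConfig 4 (h + 1 + (h + 1)) 𝕊𝕌) (m : ℝ) (t : Fin (h + 1 + (h + 1))) :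
    apDiag (torusConfigShift (Pi.single (0 : Fin 4) (1 : ZMod (h + 1 + (h + 1)))) U).timeReflect m t =
      apDiag U m (-t) :=
  sliceDiag_siteReflect U m t

omit [NeZero N] in
/-- The transfer step of the reflected field: `𝒴_t[Θ₀U] = 𝒴_{-t}[U]`. [folklore] -/
theorem apStep_siteReflect (U : GaugeConfig 4 (h + 1 + (h + 1)) 𝕊𝕌) (m : ℝ) (t : Fin (h + 1 + (h + 1))) :
    apStep (torusConfigShift (Pi.single (0 : Fin 4) (1 : ZMod (h + 1 + (h + 1)))) U).timeReflect m t =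
      apStep U m (-t) := by
  simp only [apStep, apDiag, apOff, sliceDiag_siteReflect, sliceOff_siteReflect]

omit [NeZero N] in
/-- The doubled temporal block of the reflected field: `Ŵ_t[Θ₀U] = (Ŵ_{-t-1}[U])ᴴ`. [folklore] -/
theorem linkBlock_apLink_siteReflect (U : GaugeConfig 4 (h + 1 + (h + 1)) 𝕊𝕌) (t : Fin (h + 1 + (h + 1))) :
    linkBlock (apLink (torusConfigShift (Pi.single (0 : Fin 4) (1 : ZMod (h + 1 + (h + 1)))) U).timeReflect t) =
      (linkBlock (apLink U (-t - 1)))ᴴ := by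
  rw [apLink, sliceLink_siteReflect, neg_add', linkBlock, linkBlock, Matrix.fromBlocks_conjTranspose,
    Matrix.conjTranspose_zero]

/-- **Splitting of the transfer product at the two reflection slices**:
`Ŵ_{2T-1}ᴴ𝒴_{2T-1} ⋯ Ŵ₀ᴴ𝒴₀ = 𝔓(Θ₀U)ᴴ · 𝒴_T · 𝔓(U) · 𝒴₀`. [folklore] -/
theorem transferProd_eq_reflect (U : GaugeConfig 4 (h + 1 + (h + 1)) 𝕊𝕌) {m : ℝ} (hm : -1 < m) :
    (List.ofFn fun t => (linkBlock (apLink U t))ᴴ * apStep U m t).reverse.prod =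
      (posTransfer (torusConfigShift (Pi.single (0 : Fin 4) (1 : ZMod (h + 1 + (h + 1)))) U).timeReflect m)ᴴ *
        apStep U m (Fin.natAdd (h + 1) 0) * posTransfer U m * apStep U m 0 := by
  unfold posTransfer
  exact reverse_prod_transfer_reflect (fun t => linkBlock (apLink U t)) (apStep U m)
    (fun t => linkBlock (apLink (torusConfigShift (Pi.single (0 : Fin 4) (1 : ZMod (h + 1 + (h + 1)))) U).timeReflect t))
    (apStep (torusConfigShift (Pi.single (0 : Fin 4) (1 : ZMod (h + 1 + (h + 1)))) U).timeReflect m)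
    (fun t => (posDef_apStep U hm t).isHermitian) (fun t => apStep_siteReflect U m t)
    (fun t => linkBlock_apLink_siteReflect U t)

omit [NeZero N] in
/-- **The product of the slice determinants splits over the two halves**:
`∏ₜ det a_t[U] = det a₀ · det a_T · c(U) · c(Θ₀U)`. [folklore] -/
theorem prod_det_apDiag_eq (U : GaugeConfig 4 (h + 1 + (h + 1)) 𝕊𝕌) (m : ℝ) :
    ∏ t, (apDiag U m t).det = (apDiag U m 0).det * (apDiag U m (Fin.natAdd (h + 1) 0)).det *
      posDiagDet U m * posDiagDet (torusConfigShift (Pi.single (0 : Fin 4) (1 : ZMod (h + 1 + (h + 1)))) U).timeReflect m := by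
  rw [Fin.prod_univ_add, Fin.prod_univ_succ, Fin.prod_univ_succ, posDiagDet, posDiagDet]
  have h0 : (Fin.castAdd (h + 1) (0 : Fin (h + 1)) : Fin (h + 1 + (h + 1))) = 0 := Fin.ext rfl
  have hrefl : ∏ i : Fin h, (apDiag (torusConfigShift (Pi.single (0 : Fin 4) (1 : ZMod (h + 1 + (h + 1)))) U).timeReflect m
      (Fin.castAdd (h + 1) i.succ)).det = ∏ i : Fin h, (apDiag U m (Fin.natAdd (h + 1) i.succ)).det := by
    simp only [apDiag_siteReflect]
    have hidx : ∀ i : Fin h, -(Fin.castAdd (h + 1) i.succ : Fin (h + 1 + (h + 1))) =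
        Fin.natAdd (h + 1) (Fin.rev i).succ := fun i => by
      rw [show (Fin.castAdd (h + 1) i.succ : Fin (h + 1 + (h + 1))) = Fin.castLE (Nat.le_add_right _ _) i.succ from
        Fin.ext rfl, neg_castLE_succ, Fin.rev_castSucc]
    simp only [hidx]
    exact Fintype.prod_equiv Fin.revPerm _ _ fun i => rfl
  rw [hrefl, h0]
  ring

/-- **The antiperiodic Wilson fermion determinant of an `SU(N)` gauge field is a Gram form in the
positive-time data of the field and of its site reflection** (marginal site-reflection
positivity of `det D_AP[U, m]`, `m > -1`, i.e. hopping parameter `κ < 1/6`; Lüscher 1977,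
Osterwalder–Seiler 1978 §2–3, Montvay–Münster §4.2.3 — here derived without Grassmann variables
from the transfer-matrix determinant formula and Cauchy–Binet):
`det D_AP[U] = ∑_{q', q} Φ_{q'}(U) · Q̂_{q' q}(U) · conj Φ_q(Θ₀U)` with `Q̂(U)` positive semidefinite
and depending only on the links inside the reflection planes. [folklore] -/
theorem fermionDet_wilsonDiracAP_eq_sum_gram (U : GaugeConfig 4 (h + 1 + (h + 1)) 𝕊𝕌) {m : ℝ} (hm : -1 < m) :
    fermionDet (wilsonDiracAP U m) = ∑ q', ∑ q, fermionFeature U m q' * fermionCoupling U m q' q *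
      (starRingEnd ℂ) (fermionFeature
        (torusConfigShift (Pi.single (0 : Fin 4) (1 : ZMod (h + 1 + (h + 1)))) U).timeReflect m q) := by
  rw [fermionDet_wilsonDiracAP_eq_transfer U hm, transferProd_eq_reflect U hm,
    det_one_add_eq_sum_gram _ _ _ _ (isUnit_det_apStep U hm 0), prod_det_apDiag_eq, Finset.mul_sum]
  refine Finset.sum_congr rfl fun q' _ => ?_
  rw [Finset.mul_sum]
  refine Finset.sum_congr rfl fun q _ => ?_
  simp only [fermionFeature, fermionCoupling, Matrix.smul_apply, smul_eq_mul, map_mul,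
    conj_posDiagDet _ hm]
  ring

/-- **The fermionic coupling is positive semidefinite** (`m > -1`). [folklore] -/
theorem posSemidef_fermionCoupling (U : GaugeConfig 4 (h + 1 + (h + 1)) 𝕊𝕌) {m : ℝ} (hm : -1 < m) :
    (fermionCoupling U m).PosSemidef :=
  (posSemidef_gramCoupling (posDef_apStep U hm 0) (posDef_apStep U hm _).posSemidef).smul
    (mul_nonneg (det_apDiag_pos U hm 0).le (det_apDiag_pos U hm _).le)

end FermionGram

end Literature.MathematicalPhysics.QuantumLattice

end
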